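import Literature.NumberTheory.GaloisRepresentations.CyclotomicLevels
import Literature.NumberTheory.GaloisRepresentations.AbsGaloisGroup
import HarnessLib

/-!
# Route ByReductionTypeAtTwo, crux `OrdKatoHalfAtTwoIso` (stmt-BirchSwinnertonDyer-19573), line `steinberg-fibre-at-two`
# (skeleton v11), stub `stub_coreA_posDisc : CoreTheoremAPosDiscTwo` — plan item (P2), COSET BOOKKEEPING: a complex conjugation
# lies in the coset `σ^{(ℓ−1)/2} · Gal(ℚ̄/ℚ(μ_ℓ))` of a tame generator `σ` at an odd prime `ℓ`

Seat `cruxlead-stmt-BirchSwinnertonDyer-19573-g5` (LEAD PROVER, MODE LINE; HOME `run/shared/lean/pub/bsd-2adic/`; `--supports`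
stmt-BirchSwinnertonDyer-19573 as helper). THEOREMS ONLY; nothing asserted; BSD is not proved by any of this; the crux and the
stub are NOT proved here.

WHY. The companion `…KolyvaginRealComponent.lean` shows that the Kolyvagin cocycle `Φ` of `KolyvaginTwist.exists_kolyvaginCocycle`
(coset data `G = ⊔_{i<n} σ^i N`, `res_N [Φ] = Σ_{i<n} i • σ^i·[y]`) vanishes at any involution `c` acting trivially on the
coefficients and lying in the coset `σ^k N` with `n = k + k`, `k` even. For the Ω road at `p = 2` on `0 < Δ` the involution is
a complex conjugation, `N = rootsOfUnityFixer ℚ ℓ = Gal(ℚ̄/ℚ(μ_ℓ))` and `σ` is the tame generator of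
`KolyvaginTwist.exists_generator_mem_inertia` (`σ^{ℓ−1} ∈ N`; the `σ^i`, `i < ℓ − 1`, represent `Γ_ℚ/N` exactly once). This
file supplies the coset hypothesis:

* `exists_half_of_mul_self_of_not_mem` — PURE GROUP THEORY: if `σ^n ∈ N`, the `σ^i` (`i < n`) represent `G/N` exactly once,
  `c² = 1` and `c ∉ N`, then `n = k + k` for some `k` with `(σ^k)⁻¹ c ∈ N` (`c ∈ σ^i N` forces `σ^{2i} ∈ N`, and exact
  representation forces `2i ∈ {0, n}`; `2i = 0` would put `c` in `N`).
* `not_mem_rootsOfUnityFixer_of_isComplexConjugation` — a complex conjugation of `Γ_ℚ` does not fix `μ_ℓ` for `ℓ > 2`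
  (`χ_ℓ(c) = −1 ≠ 1`, tree `modNCyclotomicCharacter_of_isComplexConjugation`, `rootsOfUnityFixer_eq_ker`).
* `exists_half_inv_pow_mul_mem_rootsOfUnityFixer_of_isComplexConjugation` — the combination, in the output shape of
  `exists_generator_mem_inertia`: `ℓ − 1 = k + k` and `(σ^k)⁻¹ c ∈ rootsOfUnityFixer ℚ ℓ`.

References: K. Rubin, *Euler Systems* (2000) §4.4 [Rubin2000]; L. Washington, *Introduction to Cyclotomic Fields* (1997) p. 19
(`χ(c) = χ(−1)`) [Washington1997]; tree `CyclotomicLevels.lean`, `ModNCyclotomicCharacter.lean`, `AbsGaloisGroup.lean`.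
-/

set_option autoImplicit false
-- the summit and its single problem are both named `BirchSwinnertonDyer` (registry layout D-0017)
set_option linter.dupNamespace false

namespace Summit.BirchSwinnertonDyer.BirchSwinnertonDyer.Rank1Residual.KolyvaginTwist

open Literature.NumberTheory.GaloisRepresentations

/-! ### §1 Pure group theory: an involution outside `N` sits in the middle coset -/

/-- **An involution outside `N` lies in the coset `σ^{n/2} N`** when the powers `σ^i`, `i < n`, represent `G/N` exactly once and
`σ^n ∈ N`: writing `c = σ^i m` (`m ∈ N`), `c² = 1` gives `σ^{2i} ∈ N` (`N` normal), so `2i ≡ 0 (mod n)` with `2i < 2n`, i.e.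
`2i ∈ {0, n}`; `i = 0` contradicts `c ∉ N`. Hence `n = i + i` and `(σ^i)⁻¹ c ∈ N`. [folklore] -/
theorem exists_half_of_mul_self_of_not_mem {G : Type*} [Group G] {N : Subgroup G} [N.Normal] {σ c : G} {n : ℕ}
    (hσn : σ ^ n ∈ N) (hcov : ∀ g : G, ∃ i < n, (σ ^ i)⁻¹ * g ∈ N)
    (hinj : ∀ i₁ < n, ∀ i₂ < n, (σ ^ i₁)⁻¹ * σ ^ i₂ ∈ N → i₁ = i₂)
    (hcc : c * c = 1) (hcN : c ∉ N) : ∃ k : ℕ, n = k + k ∧ (σ ^ k)⁻¹ * c ∈ N := by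
  obtain ⟨i, hi, him⟩ := hcov c
  -- `σ^{2i} ∈ N`: `c = σ^i m`, `1 = c c = σ^i (m σ^i) m = σ^{2i} · (σ^{-i} m σ^i) m`
  set m : G := (σ ^ i)⁻¹ * c with hm
  have hc : c = σ ^ i * m := by rw [hm, mul_inv_cancel_left]
  have hconj : (σ ^ i)⁻¹ * m * σ ^ i ∈ N := by
    have h := Subgroup.Normal.conj_mem inferInstance m him (σ ^ i)⁻¹
    rwa [inv_inv] at h
  have h2i : σ ^ (i + i) ∈ N := by
    have hprod : σ ^ (i + i) = ((σ ^ i)⁻¹ * m * σ ^ i * m)⁻¹ := by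
      have h1 : σ ^ i * m * (σ ^ i * m) = 1 := by rw [← hc, hcc]
      rw [pow_add, eq_inv_iff_mul_eq_one]
      calc σ ^ i * σ ^ i * ((σ ^ i)⁻¹ * m * σ ^ i * m)
          = σ ^ i * (σ ^ i * (σ ^ i)⁻¹) * m * σ ^ i * m := by simp only [mul_assoc]
        _ = σ ^ i * m * (σ ^ i * m) := by rw [mul_inv_cancel, mul_one]; simp only [mul_assoc]
        _ = 1 := h1
    rw [hprod]
    exact N.inv_mem (N.mul_mem hconj him)
  by_cases hlt : i + i < n
  · -- then `2i = 0`, so `c = m ∈ N`: contradiction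
    exfalso
    have h0 : (0 : ℕ) = i + i :=
      hinj 0 (lt_of_le_of_lt (Nat.zero_le _) hi) (i + i) hlt (by rwa [pow_zero, inv_one, one_mul])
    have hi0 : i = 0 := by omega
    apply hcN
    rw [hc, hi0, pow_zero, one_mul]
    exact him
  · -- `2i ≥ n`: `σ^{2i − n} ∈ N` with `2i − n < n`, so `2i = n`
    push Not at hlt
    obtain ⟨j, hj⟩ := Nat.exists_eq_add_of_le hlt
    have hjn : j < n := by omega
    have hσj : σ ^ j ∈ N := by
      have h : σ ^ (i + i) = σ ^ n * σ ^ j := by rw [hj, pow_add]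
      have h' : σ ^ j = (σ ^ n)⁻¹ * σ ^ (i + i) := by rw [h, inv_mul_cancel_left]
      rw [h']
      exact N.mul_mem (N.inv_mem hσn) h2i
    have h0 : (0 : ℕ) = j :=
      hinj 0 (lt_of_le_of_lt (Nat.zero_le _) hi) j hjn (by rwa [pow_zero, inv_one, one_mul])
    refine ⟨i, by omega, ?_⟩
    rw [← hm]
    exact him

/-! ### §2 A complex conjugation does not fix `μ_ℓ` (`ℓ > 2`) -/

/-- **A complex conjugation of `Γ_ℚ` is not in `Gal(ℚ̄/ℚ(μ_ℓ))` for `ℓ > 2`**: `χ_ℓ(c) = −1` (complex conjugation inverts roots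
of unity, tree `modNCyclotomicCharacter_of_isComplexConjugation`) and `−1 ≠ 1` in `ℤ/ℓ` for `ℓ > 2`, while
`rootsOfUnityFixer ℚ ℓ = ker χ_ℓ`. [cite: Washington1997, p. 19 (χ(c) = χ(−1))] -/
theorem not_mem_rootsOfUnityFixer_of_isComplexConjugation {ℓ : ℕ} (hℓ : 2 < ℓ)
    {c : Field.absoluteGaloisGroup ℚ} (hc : IsComplexConjugation (Rat.castHom ℝ) c) :
    c ∉ rootsOfUnityFixer ℚ ℓ := by
  haveI : NeZero ℓ := ⟨by omega⟩
  haveI : NeZero (ℓ : ℚ) := ⟨by exact_mod_cast (NeZero.ne ℓ)⟩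
  haveI : Fact (2 < ℓ) := ⟨hℓ⟩
  intro h
  rw [rootsOfUnityFixer_eq_ker, MonoidHom.mem_ker] at h
  have hval := modNCyclotomicCharacter_of_isComplexConjugation (N := ℓ) hc
  rw [h, Units.val_one] at hval
  exact ZMod.neg_one_ne_one hval.symm

/-! ### §3 The coset of a complex conjugation relative to a tame generator at `ℓ` -/

/-- **A complex conjugation lies in the coset `σ^{(ℓ−1)/2} · Gal(ℚ̄/ℚ(μ_ℓ))`** for every `σ` whose powers `σ^i`, `i < ℓ − 1`,
represent `Γ_ℚ / Gal(ℚ̄/ℚ(μ_ℓ))` exactly once with `σ^{ℓ−1} ∈ Gal(ℚ̄/ℚ(μ_ℓ))` (the output shape of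
`KolyvaginTwist.exists_generator_mem_inertia`), `ℓ > 2`: there is `k` with `ℓ − 1 = k + k` and `(σ^k)⁻¹ c ∈ rootsOfUnityFixer ℚ ℓ`
— both `σ^k` and `c` act as `−1` on `μ_ℓ`. This is the hypothesis `hcσ` of `kolyvaginCocycle_apply_eq_zero_of_even`; together
with `4 ∣ ℓ − 1` (`k` even) it makes the real component of the Kolyvagin class of `ℓ` vanish.
[cite: Rubin2000, §4.4] [cite: Washington1997, p. 19] -/
theorem exists_half_inv_pow_mul_mem_rootsOfUnityFixer_of_isComplexConjugation {ℓ : ℕ} (hℓ : 2 < ℓ)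
    {σ c : Field.absoluteGaloisGroup ℚ} (hσn : σ ^ (ℓ - 1) ∈ rootsOfUnityFixer ℚ ℓ)
    (hcov : ∀ g : Field.absoluteGaloisGroup ℚ, ∃ i < ℓ - 1, (σ ^ i)⁻¹ * g ∈ rootsOfUnityFixer ℚ ℓ)
    (hinj : ∀ i₁ < ℓ - 1, ∀ i₂ < ℓ - 1, (σ ^ i₁)⁻¹ * σ ^ i₂ ∈ rootsOfUnityFixer ℚ ℓ → i₁ = i₂)
    [(rootsOfUnityFixer ℚ ℓ).Normal] (hc : IsComplexConjugation (Rat.castHom ℝ) c) :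
    ∃ k : ℕ, ℓ - 1 = k + k ∧ (σ ^ k)⁻¹ * c ∈ rootsOfUnityFixer ℚ ℓ :=
  exists_half_of_mul_self_of_not_mem hσn hcov hinj (by rw [← pow_two]; exact hc.sq_eq_one)
    (not_mem_rootsOfUnityFixer_of_isComplexConjugation hℓ hc)

end Summit.BirchSwinnertonDyer.BirchSwinnertonDyer.Rank1Residual.KolyvaginTwist
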